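import Summits.AnomalousDissipation.AnomalousDissipation.Theorems.DenseLoudDesignerForces.Negative.KillShape
import Summits.AnomalousDissipation.AnomalousDissipation.Theorems.DenseLoudDesignerForces.Negative.FalseWithoutConvection
import Summits.AnomalousDissipation.AnomalousDissipation.Theorems.DenseLoudDesignerForces.Negative.BandLimited
import Summits.AnomalousDissipation.AnomalousDissipation.Theorems.DenseLoudDesignerForces.Negative.Scaling
import Summits.AnomalousDissipation.AnomalousDissipation.Theorems.DenseLoudDesignerForces.Negative.Planar
import Literature.Analysis.FluidPDE.LongTimeAveragePeriodic
import HarnessLib.Audit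

/-!
# Line `galilean-detuning-body-force-grid` — skeleton for crux `BaireTransfer.DenseLoudDesignerForces`
(item stmt-AnomalousDissipation-1143, route route-AnomalousDissipation-BaireTransfer; crux-plan, round 2)

Crux (FIXED, by name; unfolded by `Negative.denseLoudDesignerForces_iff = Iff.rfl`):
`∀ S₀ ∃ S ⊇ S₀ ∃ E ε > 0 ∃ U ⊆ P_S open ≠ ∅ ∀ j, U ⊆ closure LOUD_j(S,E,ε)`, where `c ∈ LOUD_j(S,E,ε)`
(`Negative.loudSet`) iff the steady designer force `f_c = Negative.force S c` carries, at SOME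
`ν ∈ (0, 1/(j+1))`, a `τ`-periodic classical NS_ν solution on `ℝ × T³` with `meanEnergy ≤ E` and
`meanDissipation_ν ≥ ε`.  Forces may be re-chosen per level; only density in `U` is asked.

## The idea (card `Ideas/galilean-detuning-body-force-grid.md`; TRIAGE-r2-1/2/3: pass ×3)

LEVER = the one free conserved quantity of the witness class, its MEAN MOMENTUM.  Look for witnesses of
the form `u(t,x) = V + w(t, x - [tV])` with a LATTICE-COMMENSURATE drift `T·V = n ∈ ℤ³` (then `u` is
`T`-periodic iff `w` is — `boost_periodic`, proved below) pointing in a direction NON-RESONANT with the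
stock (`k·n ≠ 0`, quantitatively: `goodDrifts`).  By exact Galilean covariance (`stub_galileanCovariance`)
`w` is a momentum-free classical solution of NS_ν driven by the SWEPT, time-periodic force
`(sweptForce V f_c)(t,y) = f_c(y + [tV])`; drift costs `‖V‖²` of energy and NO dissipation
(`stub_boostBudgets`).  Admissible VERBATIM: `IsClassicalNSSolutionOn` has no mean-zero clause and `LOUD_j`
accepts any period (triage N5/A6(iv)).  What it buys (card (2)–(8), re-derived by all three triagers):
the forced modes are INERTIALLY PINNED uniformly in `ν` (linear swept response `|f̂_c(k)|/(2π|k·V|)` for all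
`ν ≥ 0`; for a Kolmogorov line stock the exact swept laminar state `u*_ν = V + A_ν sin(2πm x₂ + φ_ν)e₁`,
`A_ν = F/√((2πmV₂)² + (4π²m²ν)²)`, is bounded uniformly in `ν` and QUIET, dissipation `2π²m²νA_ν² → 0` —
the 2-D twin is certified in tree: `Literature.Barriers.AnomalousDissipation.marchioroSweptState`,
`meanEnergy_marchioroSweptState_le`, `meanDissipation_marchioroSweptState_le`), so the laminar-runaway
obstruction N8/N9 that empties every near-laminar object of the undrifted problem is GONE, fixed-force
bifurcation theory happens at finite energy with a regular (third-order, no critical layer) inviscid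
stability problem, loudness becomes ONE signed quadrature Reynolds stress against a mean flow pinned in
quadrature (`ε = -(F/2σ)(⟨ρ_s⟩ + νλ⟨b⟩)`, `σ = 2πmV₂`), and physically the configuration is BODY-FORCE GRID
TURBULENCE (fluid streaming at mean velocity `V` through the steady zero-net-force grid `f_c`; Frisch 1995
§5.2 pp. 48, 51), where the zeroth law has its strongest evidence base.

## Architecture: three exact/arithmetic stubs (TRUE on paper, provable with tree material) + the residual

* `stub_galileanCovariance` (M–L) — boost of a classical solution of the swept problem is a classical
  solution of the steadily forced problem (torus-shift chain rule for `timeDerivWithin univ`, translation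
  covariance of `convect`/`laplacian`/`gradient`/`IsDivFree`).
* `stub_boostBudgets` (M) — `meanEnergy (boost V w) = ‖V‖² + meanEnergy w`, `meanDissipation ν (boost V w)
  = meanDissipation ν w` for momentum-free smooth periodic `w` and commensurate `V` (Haar invariance,
  `∫⟪V,w⟫ = 0`, spectral gradient norm blind to translations and constants, period means
  `meanEnergy_eq_of_periodic` / `meanDissipation_eq_of_periodic`).
* `stub_goodDrift` (M–L; the triage sharpening of card point (8), r2-1/r2-2) — at EVERY scale there are
  lattice drifts `n` in a fixed non-resonant cone of the stock (`|k·n| ≥ κ‖k‖‖n‖` on `S ∖ {0}`) whose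
  exactly resonant sublattice `n^⊥ ∩ ℤ³` starts at `|k|² ≥ c₀‖n‖` (well-rounded orthogonal lattice:
  the energy-trap modes sit at viscous scales when `ν ≍ 1/‖n‖`); elementary geometry of numbers.
* `stub_gridLoudness` (XL; THE RESIDUAL = the card's Transfer C⁺ sharpened to "for EVERY good drift at
  the matching scale": the zeroth law of body-force grid turbulence realised by time-periodic classical
  fluctuations, in designer/density form — forces re-chosen per level, drift direction and period
  level-dependent, budgets fixed before `U`).  Honest: loudness is untouched by the exact stubs (triage
  doubt, recorded ×3); this is where SweptHopfShore (bounded lab-periodic entry states off `u*_ν` at all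
  small `ν` for ONE force), the pinning/quadrature identity and the stroboscopic fixed-point index plug in
  as `--supports` milestones (line card §Stubs/§Hardest).

Glue (sorry-free): drift algebra (`driftVel`, `driftPeriod`, `driftPeriod_smul_driftVel`,
`norm_driftVel_sq`), `boost_periodic`, the transport lemma `mem_loudSet_of_swept_witness`
(drift-class witness ⇒ `c ∈ LOUD_j(S, E_V + E_w, ε)`), `line_glue`, and the
composition `DenseLoudDesignerForces_of : DenseLoudDesignerForces` (crux BY NAME, fed with the four stubs).

## Disproof.lean obligations honoured (cdisprove g2–g3, tree `Cruxes/DenseLoudDesignerForces/Disproof.lean`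
v15; landed `Theorems/DenseLoudDesignerForces/Negative/*`, five of them imported here and re-exported in §5)

* `denseLoudDesignerForces_false_without_convection` (§7, THE load-bearing `_false_without_`): honoured at
  `stub_gridLoudness` — the swept LINEAR/laminar response is exactly the (Oseen–)Stokes witness and is QUIET
  (dissipation `≤ 4π²νΛ_S² Σ|f̂_k|²/(2πk·V)² → 0`); every bit of `ε` the residual must produce is convective
  (the in-phase Reynolds stress `⟨ρ_s⟩`, card (4)), consistent with the Reynolds-work floor §8.
* §9 `bandLoudSet_eq_empty` / `not_window_bandLimited`: the swept laminar state and every finite-mode drift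
  state are band-limited hence quiet — never offered as witnesses; the residual's witnesses must escape every
  band (cascade), as §15's constant-flux law demands.
* §10 `mem_loudSet_iff_unit_viscosity` / `loudAt_iff_timeRescale`: the drift class is scale-covariant
  (`V ↦ λV`, `T ↦ T/λ²` keeps `T·V ∈ ℤ³` only along the discrete family — no free level is claimed, A3).
* §12 `denseLoudDesignerForces_false_planar`: drift does not de-planarise; the residual is genuinely 3-D
  (good drifts are off every coordinate plane of the stock; witnesses `w` are full 3-D fields).
* §4 refuted strengthenings AtRest/Everywhere/SameStock/FreeBudgets: `U` and the budgets are existential in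
  `stub_gridLoudness` exactly as in the crux (budgets and drift energy fixed BEFORE `U`, `U ∌ 0` intended:
  a small ball around a line-stock force of amplitude `F ≍ mE`); §11 hedge `∀ S₀ ∃ S ⊇ S₀` kept verbatim.
* §17 period floor: drift-class periods `T = ‖n‖/√E_V → ∞` along the levels — compatible.
* Negatives index (`ledger negatives`, 4 entries: FrustratedForces 2979/2984 drift ENERGY ceilings,
  DebrisQuanta 2859, TaylorCertificatePair 13037): none concerns LOUD-density; drift is used here to change
  the fluctuation dynamics, never as a source of dissipation (`stub_boostBudgets`: dissipation invariant).
-/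

set_option linter.dupNamespace false

noncomputable section

open scoped BigOperators Topology InnerProductSpace
open Filter Set Function MeasureTheory

namespace Summit.AnomalousDissipation.AnomalousDissipation.Cruxes.DenseLoudDesignerForces.GalileanDetuningBodyForceGrid

open Literature.Analysis.FunctionSpaces Literature.Analysis.FluidPDE
open Summit.AnomalousDissipation.AnomalousDissipation.Theses.BaireTransfer
open Summit.AnomalousDissipation.AnomalousDissipation.Theorems.DenseLoudDesignerForces.Negative

/-- The flat unit torus `T³`. -/
local notation "𝕋³" => UnitAddTorus (Fin 3)
/-- Real velocity values. -/
local notation "ℝ³" => EuclideanSpace ℝ (Fin 3)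
/-- Complex Fourier coefficient values. -/
local notation "ℂ³" => EuclideanSpace ℂ (Fin 3)
/-- The frequency / drift lattice `ℤ³`. -/
local notation "ℤ³" => Fin 3 → ℤ

/-! ## §0 The crux's vocabulary is the Disproof's (`Negative.force`, `Negative.loudSet`, `Negative.IsWindow`) -/

/-- Sanity (definitional): the crux unfolded through the certified kill-shape vocabulary. -/
example :
    DenseLoudDesignerForces ↔
      ∀ S₀ : Finset ℤ³, ∃ S : Finset ℤ³, S₀ ⊆ S ∧ ∃ (E ε : ℝ), 0 < ε ∧
        ∃ U : Set (↥S → ℂ³), IsWindow S E ε U :=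
  denseLoudDesignerForces_iff

/-! ## §1 Galilean vocabulary: swept force, boost, lattice-commensurate drifts -/

/-- The SWEPT force seen in the frame moving with the mean momentum `V`:
`(sweptForce V F) t y = F (y + [tV])` — a travelling wave, time-periodic as soon as `T·V ∈ ℤ³`. -/
def sweptForce (V : ℝ³) (F : 𝕋³ → ℝ³) : ℝ → 𝕋³ → ℝ³ :=
  fun t y => F (y + Torus.proj (t • V))

/-- The Galilean BOOST of a fluctuation `w` by the mean momentum `V`: `u t x = V + w t (x - [tV])`. -/
def boost (V : ℝ³) (w : ℝ → 𝕋³ → ℝ³) : ℝ → 𝕋³ → ℝ³ :=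
  fun t x => V + w t (x - Torus.proj (t • V))

/-- The transported pressure `p t x = q t (x - [tV])`. -/
def boostScalar (V : ℝ³) (q : ℝ → 𝕋³ → ℝ) : ℝ → 𝕋³ → ℝ :=
  fun t x => q t (x - Torus.proj (t • V))

/-- The drift VELOCITY attached to a lattice vector `n ≠ 0` and a drift energy `E_V`: speed `√E_V` along `n`. -/
def driftVel (EV : ℝ) (n : ℤ³) : ℝ³ :=
  (Real.sqrt EV / ‖Torus.latticeVec n‖) • Torus.latticeVec n

/-- The drift PERIOD `T = ‖n‖/√E_V`, making the drift lattice-commensurate: `T · driftVel = n`. -/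
def driftPeriod (EV : ℝ) (n : ℤ³) : ℝ :=
  ‖Torus.latticeVec n‖ / Real.sqrt EV

/-- GOOD DRIFTS for the stock `S` with constants `κ, c₀ > 0` (card point (8) + triage sharpenings r2-1/r2-2; a
`Set`, not a predicate, so that no proposition is defined in this file): `n ≠ 0`; every non-zero stock mode is
UNIFORMLY non-resonant, `|k·n| ≥ κ‖k‖‖n‖` (so its sweeping rate `2π|k·driftVel| ≥ 2πκ√E_V‖k‖` is `O(1)` and
`ν`-independent — no laminar runaway on the stock, N8/N9); and the exactly resonant sublattice `n^⊥ ∩ ℤ³` (modes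
feeling no sweeping, damped by viscosity only: the 2½-D energy trap of periodic shear DNS) starts at
`|k|² ≥ c₀‖n‖`, i.e. at viscous scales when `ν ≍ 1/‖n‖`.  For `‖n‖ > 4Λ_S²/c₀` the second clause also forbids
second-order streaming `k ± k' ∈ n^⊥ ∖ {0}` from pairs of stock modes. -/
def goodDrifts (S : Finset ℤ³) (κ c₀ : ℝ) : Set ℤ³ :=
  {n | n ≠ 0 ∧
    (∀ k ∈ S, k ≠ 0 → κ * (‖Torus.latticeVec k‖ * ‖Torus.latticeVec n‖) ≤
      |⟪Torus.latticeVec k, Torus.latticeVec n⟫_ℝ|) ∧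
    (∀ k : ℤ³, k ≠ 0 → ⟪Torus.latticeVec k, Torus.latticeVec n⟫_ℝ = 0 →
      c₀ * ‖Torus.latticeVec n‖ ≤ ‖Torus.latticeVec k‖ ^ 2)}

/-- The SWEPT LOUD SET of level `j` for the drift `n` with drift energy `E_V`: coefficient vectors `c` whose
swept force `f_c(· + [t·driftVel])` carries, at SOME `ν ∈ (0, 1/(j+1))`, a MOMENTUM-FREE classical solution
`(w, q)` on `ℝ × T³`, periodic with the drift period, with fluctuation budgets `meanEnergy w ≤ E_w`,
`meanDissipation ν w ≥ ε` (the drift-class witnesses of the card's Transfer C⁺, read in the swept frame). -/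
def sweptLoudSet (S : Finset ℤ³) (Ew ε EV : ℝ) (n : ℤ³) (j : ℕ) : Set (↥S → ℂ³) :=
  {c | ∃ ν : ℝ, 0 < ν ∧ ν < 1 / ((j : ℝ) + 1) ∧
    ∃ (w : ℝ → 𝕋³ → ℝ³) (q : ℝ → 𝕋³ → ℝ),
      Torus.IsClassicalNSSolutionOn Set.univ ν (sweptForce (driftVel EV n) (force S c)) w q ∧
      Function.Periodic w (driftPeriod EV n) ∧ (∀ t, Torus.HasZeroMean (w t)) ∧
      meanEnergy w ≤ Ew ∧ ε ≤ meanDissipation ν w}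

/-! ## §2 The four statements of the line

They are the TYPES of the four registered stubs of §3 (no `Prop` is defined in this file; the glue of §4 takes the
statements it needs as explicit hypotheses, so every glue lemma is sorry-free and reusable the day a stub lands):

1. Galilean covariance (`stub_galileanCovariance`): if `(w, q)` is a classical solution on `ℝ × T³` of NS_ν driven
   by the swept force `F(y + [tV])`, then `u = V + w(t, x - [tV])`, `p = q(t, x - [tV])` is a classical solution of
   NS_ν driven by the STEADY force `F` (`∂ₜu = ∂ₜw - Dw[V]`, `(u·∇)u = Dw[V] + (w·∇)w`: the drift terms cancel;
   `Δ`, `∇`, `div` commute with translations).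
2. Budgets of a boost (`stub_boostBudgets`): for a lattice-commensurate drift (`T·V = n`, `T > 0`) and a smooth,
   `T`-periodic, momentum-free `w`: `meanEnergy (boost V w) = ‖V‖² + meanEnergy w` and
   `meanDissipation ν (boost V w) = meanDissipation ν w` — drift never creates dissipation.
3. Good drifts exist at every scale (`stub_goodDrift`): `∀ S ∃ κ c₀ > 0 ∀ N ∃ n ∈ goodDrifts S κ c₀, ‖n‖ ≥ N`.
4. GRID LOUDNESS (`stub_gridLoudness`; the residual = the card's Transfer C⁺ sharpened to EVERY good drift at the
   matching scale): `∀ S₀ ∃ S ⊇ S₀ ∀ κ c₀ > 0 ∃ E_V > 0, E_w, ε > 0, N₀ : ℕ → ℕ, U open ≠ ∅ ∀ j ∀ n ∈ goodDrifts S κ c₀`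
   with `‖n‖ ≥ N₀ j` (a level-dependent scale threshold chosen by the prover, e.g. `N₀ j ≍ (j+1)/c₀` so that the
   matching viscosity `ν ≍ 1/(c₀‖n‖)` is `< 1/(j+1)`): `U ⊆ closure (sweptLoudSet S E_w ε E_V n j)` — body-force
   grid turbulence (fluid
   streaming with the commensurate mean momentum `driftVel E_V n` through the steady grid `f_c`) carries,
   densely in the force, drift-periodic classical fluctuations with bounded energy and dissipation `≥ ε` at some
   `ν < 1/(j+1)`.  Formally STRONGER than the crux on the drift subclass; it
   USES the crux's designer freedom: the loud `c' ∈ U` and the drift `(n, T)` move with the level.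
-/

/-! ## §3 Registered stubs -/

/-- **stub_galileanCovariance** (size M–L; TRUE: exact identity).  Galilean covariance of classical
Navier–Stokes solutions on `ℝ × T³` under a uniformly moving frame: swept-force solutions boost to
steady-force solutions.  Proof route with tree material: `Torus.IsSmoothSpaceTimeOn` of the composite with the
affine map `(t, x̃) ↦ (t, x̃ - tV)` (`stLift (boost V w) (t,x̃) = V + stLift w (t, x̃ - tV)`); chain rule for
`timeDerivWithin univ = deriv` giving `∂ₜw(t)(y) - Torus.fderiv (w t) y V` at `y = x - [tV]`;
`Torus.convect (u t) (u t) x = Torus.fderiv (w t) y (V + w t y)` (derivative of a translate, constants drop);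
`Torus.laplacian`/`Torus.gradient`/`Torus.divergence` of translates (`liftAt (g ∘ (· - a)) x = liftAt g (x - a)`).
Nearest tree lemma: `translate_isClassical` (Cruxes/RobustLoudUpgrade/Disproof.lean §11, static translations).
Leans on: `Torus.IsClassicalNSSolutionOn` (TorusFluidGlue:151), `Torus.timeDerivWithin`, `Torus.convect`,
`Torus.proj_add`; Mathlib `HasDerivAt.comp`, `fderiv` of translations. -/
theorem stub_galileanCovariance :
    ∀ (ν : ℝ) (V : ℝ³) (F : 𝕋³ → ℝ³) (w : ℝ → 𝕋³ → ℝ³) (q : ℝ → 𝕋³ → ℝ),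
      Torus.IsClassicalNSSolutionOn Set.univ ν (sweptForce V F) w q →
        Torus.IsClassicalNSSolutionOn Set.univ ν (fun _ => F) (boost V w) (boostScalar V q) := by
  sorry

/-- **stub_boostBudgets** (size M; TRUE: exact identities).  Energy and dissipation bookkeeping of a
lattice-commensurate boost of a smooth periodic momentum-free fluctuation.  Proof route: `boost V w` is
`T`-periodic (`boost_periodic` below), so both means are period means (`meanEnergy_eq_of_periodic`,
`meanDissipation_eq_of_periodic`, LongTimeAveragePeriodic:157/169); slice-wise `∫‖V + w t (x - a)‖² dx =
∫‖V + w t x‖² dx` (Haar: `MeasureTheory.integral_sub_right_eq_self` on the compact group `T³`) `= ‖V‖² +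
2⟪V, ∫ w t⟫ + ∫‖w t‖²` (`integral_inner`, probability measure, `HasZeroMean`) and interval-integrability of the
continuous slice energy (smoothness) to split `∫₀ᵀ`; `Torus.eGradNormSq (boost V w t) = Torus.eGradNormSq (w t)`
from `mFourierCoeff` of a translate (`= e^{-2πik·a} ŵ(k)`) and of a constant (supported at `k = 0`, weight `0`).
Leans on: `meanEnergy`/`meanDissipation` (ZerothLaw:146/154), `Torus.eGradNormSq` (TorusFluidGlue:110),
`TorusFourierCalculus`, Mathlib Haar invariance on `UnitAddTorus`. -/
theorem stub_boostBudgets :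
    ∀ (ν : ℝ) (V : ℝ³) (n : ℤ³) (T : ℝ) (w : ℝ → 𝕋³ → ℝ³), 0 < T → T • V = Torus.latticeVec n →
      Torus.IsSmoothSpaceTimeOn Set.univ w → Function.Periodic w T → (∀ t, Torus.HasZeroMean (w t)) →
        meanEnergy (boost V w) = ‖V‖ ^ 2 + meanEnergy w ∧
          meanDissipation ν (boost V w) = meanDissipation ν w := by
  sorry

/-- **stub_goodDrift** (size M–L; TRUE: elementary geometry of numbers).  For every finite `S ⊆ ℤ³` there are
`κ, c₀ > 0` with good drifts at every scale.  Proof route (explicit family): pick a primitive `p ∈ ℤ³` off the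
finitely many planes `k^⊥`, `k ∈ S ∖ {0}` (a finite union of planes does not cover `ℤ³`), an integer basis
`f₁, f₂` of `p^⊥ ∩ ℤ³` (`f₁ × f₂ = ±p`) and small integer `w₁, w₂`; put `b₁ = a f₁ + w₁`, `b₂ = a f₂ + w₂`,
`n_a = b₁ × b₂ = a²p + a s + r`.  Then `b₁, b₂ ⊥ n_a`, `‖b_i‖ ≍ a ≍ ‖n_a‖^{1/2}`, the angle of `(b₁, b₂)` tends
to that of `(f₁, f₂)`, so every non-zero vector of `ℤb₁ + ℤb₂` has norm `≥ c a`; arranging `gcd(n_a) = 1`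
(choice of `w₁, w₂` / of `a` in a residue class) makes `{b₁, b₂}` a basis of `n_a^⊥ ∩ ℤ³`, whence
`λ₁(n_a^⊥ ∩ ℤ³)² ≥ c₀‖n_a‖`; and `|k·n_a| ≥ a²|k·p| - O(a‖k‖) ≥ κ‖k‖‖n_a‖` for `a` large with
`κ = min_{k ∈ S∖{0}} |k·p|/(2‖k‖‖p‖)`.  Alternative: counting — among the `≍ R³` lattice points of a fixed
non-resonant cone at scale `R`, those with a resonant `k`, `‖k‖² < c₀R`, number `≲ Σ_{‖k‖² < c₀R} (R²/‖k‖ + R)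
≲ c₀R³`.  Leans on: `Torus.latticeVec(_apply)` (FlatTorus:147), Mathlib `Finset`/`Int` arithmetic,
`crossProduct` (Mathlib `Mathlib.LinearAlgebra.CrossProduct`). -/
theorem stub_goodDrift :
    ∀ S : Finset ℤ³, ∃ κ : ℝ, 0 < κ ∧ ∃ c₀ : ℝ, 0 < c₀ ∧
      ∀ N : ℕ, ∃ n : ℤ³, n ∈ goodDrifts S κ c₀ ∧ (N : ℝ) ≤ ‖Torus.latticeVec n‖ := by
  sorry

/-- **stub_gridLoudness** (size XL; THE RESIDUAL — honestly crux-sized on the drift subclass; held by the lead).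
The zeroth law of BODY-FORCE GRID TURBULENCE realised by time-periodic classical fluctuations, in designer /
density form: Statement 4 of §2.  Intended construction (card (3)–(8), triage sharpenings): `S := S₀ ∪ {±m e₂}`
(Kolmogorov line stock, `m ≥ 2`), `U` a small ball around the line-stock force of amplitude `F` with
`F ≤ √2·π m·E` (window ceiling [D§6] saturated, card (3)), `E_V ≍ E/2`, `ν ≍ 1/‖n‖`; witnesses = UPOs of the
swept problem, i.e. fixed points of iterates of the stroboscopic map `P_{c,ν}` (time-`T` map of the
`T`-periodically forced NS_ν, compact analytic; fixed points generically ISOLATED, Leray–Schauder / Lefschetz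
index available without hyperbolicity, card (6)) inside the loud region.  WHY PLAUSIBLE: (i) explicit,
`ν`-independent, bounded quiet base `u*_ν` (swept Kolmogorov flow with cross-flow) — the bounded half of the
dynamics lives at finite energy for ONE fixed force at ALL small `ν`; (ii) REGULAR inviscid limit of its
stability problem (third-order Rayleigh equation with cross-flow, leading coefficient `V₂ ≠ 0`: no critical
layer; the advection operator `V₂∂_y + iαA sin(2πmy)` is gauge-conjugate to `V₂∂_y`, pure point spectrum —
triage r2-2/r2-3), so neutral curves and Landau data converge as `ν → 0` and equivariant Hopf gives
travelling-wave (lab-periodic) branches at all small `ν` = milestone SweptHopfShore; (iii) loudness = ONE signed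
quadrature Reynolds stress `-⟨∫ sin(2πm x₂) u′₁u′₂⟩ ≥ εV₂/F + O(ν)` against a mean flow pinned in quadrature
(`σ⟨b⟩ = -(F + ⟨ρ_c⟩ - νλ⟨a⟩)`, exact from `momentum_period_identity` [D§5] + `meanDissipation_eq_meanPower`
[D§3]) = milestone PinningQuadrature; (iv) grid-turbulence evidence (`ε = ½C_D U³/L` with `Re`-independent drag
coefficient, Sreenivasan 1984 apud Frisch 1995 p. 48) and a one-parameter deformation (cross-flow) of standard
3-D Kolmogorov UPO searches.  WHY IT MIGHT FAIL: excursion-type orbits anchored at `u*_ν` are quiet at large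
levels (g2 budget audit B8: idling time `≳ ν^{-3/2}` per lap) so witnesses must be recurrent INSIDE the loud
region — existence of such UPOs at every `Re` is the chaotic-hypothesis-grade open core (BuckmasterVicol2019
barrier: no constructive tool supplies classical periodic witnesses); boundedness of the fluctuation energy for
the unforced large scales nearly orthogonal to `n` (only `ν^{1/2}`…`O(1)`-detuned) is nonlinear saturation, not
delivered by detuning; cross-flow might stabilise `u*_ν` for all admissible `κ = A/V₂` at small `ν` (falsifier
(a): kit j009438/j009714/j009378/j009497/j009409, five independent runs filed by ideator and triagers; triage
r2-3 resolves it on paper in favour of finite `κ_c(ν) = O(1)` by regular perturbation of the Meshalkin–Sinai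
long-wave instability).  USES the `_false_without_convection` hypothesis here and only here.
Leans on: `sweptLoudSet`, `goodDrifts`, tree `LinearizedNSTorus` vocabulary (definitions only) for (ii),
`Negative.momentum_period_identity`, `Negative.meanDissipation_eq_meanPower`; literature NOT in tree: Iooss 1972 /
Chossat–Iooss 1994 Ch. 3 (equivariant Hopf ⇒ rotating/travelling waves), Prodi 1960 / Kyed–Galdi (time-periodic
forcing ⇒ time-periodic solutions), Leray–Schauder index, van Veen–Kida–Kawahara 2006 (arXiv:1804.00547),
van Veen–Vela-Martín–Kawahara PRL 123 (2019) 134502, Frisch1995 §5.2. -/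
theorem stub_gridLoudness :
    ∀ S₀ : Finset ℤ³, ∃ S : Finset ℤ³, S₀ ⊆ S ∧
      ∀ κ : ℝ, 0 < κ → ∀ c₀ : ℝ, 0 < c₀ →
        ∃ (EV Ew ε : ℝ), 0 < EV ∧ 0 < ε ∧ ∃ (N₀ : ℕ → ℕ) (U : Set (↥S → ℂ³)), IsOpen U ∧ U.Nonempty ∧
          ∀ (j : ℕ) (n : ℤ³), n ∈ goodDrifts S κ c₀ → ((N₀ j : ℕ) : ℝ) ≤ ‖Torus.latticeVec n‖ →
            U ⊆ closure (sweptLoudSet S Ew ε EV n j) := by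
  sorry

/-! ## §4 Glue (sorry-free): drift algebra, periodicity of boosts, transport of swept witnesses, composition -/

/-- A non-zero lattice vector has a non-zero real image. -/
theorem latticeVec_ne_zero {n : ℤ³} (hn : n ≠ 0) : Torus.latticeVec n ≠ 0 := by
  intro h
  apply hn
  funext i
  have hi := congrArg (fun v : ℝ³ => v i) h
  simp only [Torus.latticeVec_apply, PiLp.zero_apply] at hi
  exact_mod_cast hi

/-- … hence positive norm. -/
theorem norm_latticeVec_pos {n : ℤ³} (hn : n ≠ 0) : 0 < ‖Torus.latticeVec n‖ :=
  norm_pos_iff.2 (latticeVec_ne_zero hn)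

/-- The drift period is positive. -/
theorem driftPeriod_pos {EV : ℝ} (hEV : 0 < EV) {n : ℤ³} (hn : n ≠ 0) : 0 < driftPeriod EV n :=
  div_pos (norm_latticeVec_pos hn) (Real.sqrt_pos.2 hEV)

/-- **Lattice commensurability of the drift**: `T · V = n`. -/
theorem driftPeriod_smul_driftVel {EV : ℝ} (hEV : 0 < EV) {n : ℤ³} (hn : n ≠ 0) :
    driftPeriod EV n • driftVel EV n = Torus.latticeVec n := by
  have h1 : (0 : ℝ) < ‖Torus.latticeVec n‖ := norm_latticeVec_pos hn
  have h2 : (0 : ℝ) < Real.sqrt EV := Real.sqrt_pos.2 hEV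
  have h3 : driftPeriod EV n * (Real.sqrt EV / ‖Torus.latticeVec n‖) = 1 := by
    rw [driftPeriod, div_mul_div_comm, mul_comm ‖Torus.latticeVec n‖ (Real.sqrt EV)]
    exact div_self (mul_pos h2 h1).ne'
  rw [driftVel, smul_smul, h3, one_smul]

/-- The drift speed is `√E_V`. -/
theorem norm_driftVel {EV : ℝ} {n : ℤ³} (hn : n ≠ 0) : ‖driftVel EV n‖ = Real.sqrt EV := by
  have h1 : (0 : ℝ) < ‖Torus.latticeVec n‖ := norm_latticeVec_pos hn
  rw [driftVel, norm_smul, norm_div, Real.norm_of_nonneg (Real.sqrt_nonneg _), Real.norm_of_nonneg h1.le,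
    div_mul_cancel₀ _ h1.ne']

/-- The drift kinetic energy is `E_V`. -/
theorem norm_driftVel_sq {EV : ℝ} (hEV : 0 ≤ EV) {n : ℤ³} (hn : n ≠ 0) : ‖driftVel EV n‖ ^ 2 = EV := by
  rw [norm_driftVel hn, Real.sq_sqrt hEV]

/-- **Periodicity of boosts**: for a lattice-commensurate drift, `T·V = n ∈ ℤ³`, the boost of a `T`-periodic
fluctuation is `T`-periodic — the one-parameter subgroup generated by a lattice vector is CLOSED in `T³`
(`Torus.proj_latticeVec`). -/
theorem boost_periodic {V : ℝ³} {n : ℤ³} {T : ℝ} (hTV : T • V = Torus.latticeVec n) {w : ℝ → 𝕋³ → ℝ³}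
    (hper : Function.Periodic w T) : Function.Periodic (boost V w) T := by
  intro t
  funext x
  simp only [boost]
  rw [hper t, add_smul, Torus.proj_add, hTV, Torus.proj_latticeVec, add_zero]

/-- **Transport of a drift-class witness** (the card's `mem_loudSet_of_swept_witness`, from Statements 1–2 taken as
hypotheses): a momentum-free, drift-periodic classical solution of the swept problem with fluctuation budgets
`(E_w, ε)` puts `c` in `LOUD_j(S, E, ε)` for every `E ≥ E_V + E_w`, with the lab-frame witness
`boost (driftVel E_V n) w`.  Sorry-free: an evidence adapter the day Statements 1–2 land. -/
theorem mem_loudSet_of_swept_witness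
    (hcov : ∀ (ν : ℝ) (V : ℝ³) (F : 𝕋³ → ℝ³) (w : ℝ → 𝕋³ → ℝ³) (q : ℝ → 𝕋³ → ℝ),
      Torus.IsClassicalNSSolutionOn Set.univ ν (sweptForce V F) w q →
        Torus.IsClassicalNSSolutionOn Set.univ ν (fun _ => F) (boost V w) (boostScalar V q))
    (hbud : ∀ (ν : ℝ) (V : ℝ³) (n : ℤ³) (T : ℝ) (w : ℝ → 𝕋³ → ℝ³), 0 < T → T • V = Torus.latticeVec n →
      Torus.IsSmoothSpaceTimeOn Set.univ w → Function.Periodic w T → (∀ t, Torus.HasZeroMean (w t)) →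
        meanEnergy (boost V w) = ‖V‖ ^ 2 + meanEnergy w ∧ meanDissipation ν (boost V w) = meanDissipation ν w)
    {S : Finset ℤ³} {E Ew ε EV : ℝ} {n : ℤ³} {j : ℕ} {c : ↥S → ℂ³} (hEV : 0 < EV) (hn : n ≠ 0)
    (hE : EV + Ew ≤ E) (hc : c ∈ sweptLoudSet S Ew ε EV n j) : c ∈ loudSet S E ε j := by
  obtain ⟨ν, hν, hνj, w, q, hsol, hper, hmean, hEw, hεw⟩ := hc
  have hT : 0 < driftPeriod EV n := driftPeriod_pos hEV hn
  have hTV : driftPeriod EV n • driftVel EV n = Torus.latticeVec n := driftPeriod_smul_driftVel hEV hn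
  obtain ⟨hEn, hDis⟩ :=
    hbud ν (driftVel EV n) n (driftPeriod EV n) w hT hTV hsol.smooth_velocity hper hmean
  refine ⟨ν, hν, hνj, driftPeriod EV n, boost (driftVel EV n) w, boostScalar (driftVel EV n) q, hT,
    hcov ν (driftVel EV n) (force S c) w q hsol, boost_periodic hTV hper, ?_, ?_⟩
  · rw [hEn, norm_driftVel_sq hEV.le hn]
    linarith
  · rw [hDis]
    exact hεw

/-- **Line glue** (modular; its conclusion is deliberately the UNFOLDED crux in `Negative.IsWindow` shape, so that
exactly one theorem of this file — `DenseLoudDesignerForces_of` — concludes the crux by name).  Hypotheses: the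
TRANSPORT inclusion `sweptLoudSet ⊆ loudSet` (= Statements 1–2 via `mem_loudSet_of_swept_witness`), Statement 3 and
Statement 4.  Proof: for `S₀` take `S ⊇ S₀` from grid loudness, `κ, c₀` from the good-drift lemma for `S`, budgets
`(E_V + E_w, ε)` and the window `U`; at level `j` pick a good drift at scale `≥ N₀ j`, get density of the
swept loud set in `U`, transport it into `LOUD_j(S, E_V + E_w, ε)` by `closure_mono`. -/
theorem line_glue
    (htrans : ∀ (S : Finset ℤ³) (Ew ε EV : ℝ) (n : ℤ³) (j : ℕ), 0 < EV → n ≠ 0 →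
      sweptLoudSet S Ew ε EV n j ⊆ loudSet S (EV + Ew) ε j)
    (hdrift : ∀ S : Finset ℤ³, ∃ κ : ℝ, 0 < κ ∧ ∃ c₀ : ℝ, 0 < c₀ ∧
      ∀ N : ℕ, ∃ n : ℤ³, n ∈ goodDrifts S κ c₀ ∧ (N : ℝ) ≤ ‖Torus.latticeVec n‖)
    (hgrid : ∀ S₀ : Finset ℤ³, ∃ S : Finset ℤ³, S₀ ⊆ S ∧
      ∀ κ : ℝ, 0 < κ → ∀ c₀ : ℝ, 0 < c₀ →
        ∃ (EV Ew ε : ℝ), 0 < EV ∧ 0 < ε ∧ ∃ (N₀ : ℕ → ℕ) (U : Set (↥S → ℂ³)), IsOpen U ∧ U.Nonempty ∧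
          ∀ (j : ℕ) (n : ℤ³), n ∈ goodDrifts S κ c₀ → ((N₀ j : ℕ) : ℝ) ≤ ‖Torus.latticeVec n‖ →
            U ⊆ closure (sweptLoudSet S Ew ε EV n j)) :
    ∀ S₀ : Finset ℤ³, ∃ S : Finset ℤ³, S₀ ⊆ S ∧ ∃ (E ε : ℝ), 0 < ε ∧
      ∃ U : Set (↥S → ℂ³), IsWindow S E ε U := by
  intro S₀
  obtain ⟨S, hS, hgridS⟩ := hgrid S₀
  obtain ⟨κ, hκ, c₀, hc₀, hgood⟩ := hdrift S
  obtain ⟨EV, Ew, ε, hEV, hε, N₀, U, hU, hUne, hdense⟩ := hgridS κ hκ c₀ hc₀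
  refine ⟨S, hS, EV + Ew, ε, hε, U, ?_⟩
  show IsOpen U ∧ U.Nonempty ∧ ∀ j : ℕ, U ⊆ closure (loudSet S (EV + Ew) ε j)
  refine ⟨hU, hUne, fun j => ?_⟩
  obtain ⟨n, hgoodn, hnN⟩ := hgood (N₀ j)
  exact (hdense j n hgoodn hnN).trans (closure_mono (htrans S Ew ε EV n j hEV hgoodn.1))

/-- **Composition: the four stubs prove the crux `DenseLoudDesignerForces` BY NAME** (the audit's skeleton
theorem; no hypotheses; sorries only inside `stub_*`). -/
theorem DenseLoudDesignerForces_of :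
    Summit.AnomalousDissipation.AnomalousDissipation.Theses.BaireTransfer.DenseLoudDesignerForces :=
  denseLoudDesignerForces_iff.2
    (line_glue
      (fun _ _ _ _ _ _ hEV hn _ hc =>
        mem_loudSet_of_swept_witness stub_galileanCovariance stub_boostBudgets hEV hn le_rfl hc)
      stub_goodDrift stub_gridLoudness)

/-! ## §5 Disproof obligations in scope (landed `Negative/*` lemmas the stubs are checked against) -/

-- [D§7] the convective term is load-bearing: with Stokes witnesses the crux is false — honoured by
-- `stub_gridLoudness` (the swept linear response is the quiet Oseen–Stokes witness).
example : ¬ DenseLoudDesignerForcesWithoutConvection := denseLoudDesignerForces_false_without_convection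

-- [D§9] band-limited witnesses are quiet: the residual's witnesses must escape every Fourier band.
example := @bandLoudSet_eq_empty

-- [D§10] scale covariance / Grashof form of the loud set (no free level from rescaling one orbit).
example := @mem_loudSet_iff_unit_viscosity

-- [D§12] the planar analogue of the crux is false: good drifts and witnesses are genuinely 3-D.
example : ¬ DenseLoudDesignerForcesPlanar := denseLoudDesignerForces_false_planar

end Summit.AnomalousDissipation.AnomalousDissipation.Cruxes.DenseLoudDesignerForces.GalileanDetuningBodyForceGrid

end
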